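import Summits.AnomalousDissipation.AnomalousDissipation.Theorems.SolenoidalFractalHomogenisationLagrangianStepCellLawVSlowGraphTracking
import HarnessLib

/-!
# K1L `LagrangianRenormalisationStep(Design)` (K1L_D, stmt-AnomalousDissipation-27980; aside 24912), stub `stub_cellLawV0_IS`
# — the ABSTRACT SLOW-GRAPH LEVER, part 8: the LINEAR periodic response `Ṅ = A₂₁ + A₂₂N` (first-order cell corrector) and its distance to the Riccati graph
# (helper; `--supports stmt-AnomalousDissipation-27980`; word-independent)

Summits-side helper file of route `SolenoidalFractalHomogenisation` (planner ad-ideate-p5's STUB-PLAN for `stub_cellLawV` §1 (V) V3 and §7 (a), tenure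
D24-1 «`Φν` := period mean of the reduced generator on the graph»; crux idea `chang-slow-graph`, `SlowGraphSketch` G3 «the graph is its second-order
(Duhamel) part up to a relatively quadratic error — the source of `σ = 2`»), on top of parts 1–6.  THE POINT FOR D1.  The periodic Riccati graph `M`
(part 6) is a nonlinear object; its LINEAR part — the `P`-periodic solution `N` of `Ṅ = A₂₁ + A₂₂N` (in the cell system: the periodic first-order
corrector, LINEAR in the slow–fast coupling hence exactly quadratic in the Bloch momentum; `−mean(A₁₂N)` is the Green–Kubo / cell-corrector formula of
classical homogenisation) — exists by the SAME lever (Chang's equation with `A₁₁ = A₁₂ = 0`), and differs from `M` by G3's relatively quadratic amount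
plus a transient:
* §16 `linearGraph_periodic_on` — `N` on `[0, T]`, `‖N‖ ≤ 2δ/γ`, `N (t + P) = N t` (part 6's `riccatiGraph_periodic_on` at `A₁₁ = A₁₂ = 0`, `s₀ = 0`);
* §17 `norm_riccati_sub_linear_le` — for the periodic Riccati graph `M` (`‖M 0‖ ≤ r = 2δ/(γ−s₀)`) and any periodic linear response `N` (`‖N 0‖ ≤ 2δ/γ`):
  `‖M t − N t‖ ≤ r(s₀ + δr)/γ + (r + 2δ/γ)·e^{−γt/2}` on `[0, T]` (G3 `duhamelRemainder` against the linear solution from `M 0`, which exists by G0′ run with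
  the maximal admissible coupling constant `δ′ = γ/√8` (ball radius `1/√2 ≥ r`), then G4 at `A₁₁ = A₁₂ = 0` with rate `γ(1 − ½) = γ/2`).
No named facts, no new definitions, no sorry.  Infrastructure for route-1's rung leaf F-D1.A0 (frontier FORMAL rung); NOT a proof of the stub, of the crux,
of Onsager's conjecture or of anomalous dissipation.  Prover seat `ad-k1l-cellLawV-w1` g3, 2026-08-28.
-/

set_option linter.dupNamespace false

noncomputable section

namespace Summit.AnomalousDissipation.AnomalousDissipation.Theorems.SolenoidalFractalHomogenisation.LagrangianStep

namespace SlowGraph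

open Set Filter Topology Metric MeasureTheory intervalIntegral
open scoped InnerProductSpace NNReal

/-! ## §16 The periodic LINEAR response `Ṅ = A₂₁ + A₂₂N` -/

section Linear

/-- Chang's Riccati field with `A₁₁ = 0`, `A₁₂ = 0` is the linear inhomogeneous field `A₂₁ + A₂₂N`. [folklore] -/
theorem riccati_zero_zero {E F : Type*} [NormedAddCommGroup E] [InnerProductSpace ℝ E] [NormedAddCommGroup F] [InnerProductSpace ℝ F]
    (A₂₁ : E →L[ℝ] F) (A₂₂ : F →L[ℝ] F) (N : E →L[ℝ] F) :
    A₂₁ + A₂₂.comp N - N.comp (0 : E →L[ℝ] E) - (N.comp (0 : F →L[ℝ] E)).comp N = A₂₁ + A₂₂.comp N := by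
  simp

/-- **THE PERIODIC LINEAR RESPONSE** (first-order corrector): for `A₂₁, A₂₂` continuous and `P`-periodic on `[0, T]` (`0 < P ≤ T`), `A₂₂`
`γ`-dissipative, `‖A₂₁‖ ≤ δ`, `8δ² ≤ γ²`, there is a solution `N` of `Ṅ = A₂₁ + A₂₂N` on `[0, T)`, continuous on `[0, T]`, with `‖N t‖ ≤ 2δ/γ` and
`N (t + P) = N t` — part 6's `riccatiGraph_periodic_on` at `A₁₁ = 0`, `A₁₂ = 0`, `s₀ = 0`. [folklore] -/
theorem linearGraph_periodic_on (E F : Type) [NormedAddCommGroup E] [InnerProductSpace ℝ E] [FiniteDimensional ℝ E]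
    [NormedAddCommGroup F] [InnerProductSpace ℝ F] [FiniteDimensional ℝ F]
    (A₂₁ : ℝ → E →L[ℝ] F) (A₂₂ : ℝ → F →L[ℝ] F) (γ δ P T : ℝ)
    (hδ : 0 ≤ δ) (hγ : 0 < γ) (h8 : 8 * δ ^ 2 ≤ γ ^ 2) (hP : 0 < P) (hPT : P ≤ T)
    (hA₂₂ : ∀ t ∈ Icc 0 T, ∀ z : F, ⟪A₂₂ t z, z⟫_ℝ ≤ -γ * ‖z‖ ^ 2) (h₂₁ : ∀ t ∈ Icc 0 T, ‖A₂₁ t‖ ≤ δ)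
    (hc₂₁ : ContinuousOn A₂₁ (Icc 0 T)) (hc₂₂ : ContinuousOn A₂₂ (Icc 0 T))
    (hp₂₁ : ∀ t, 0 ≤ t → t + P ≤ T → A₂₁ (t + P) = A₂₁ t) (hp₂₂ : ∀ t, 0 ≤ t → t + P ≤ T → A₂₂ (t + P) = A₂₂ t) :
    ∃ N : ℝ → E →L[ℝ] F, ContinuousOn N (Icc 0 T) ∧ (∀ t ∈ Ico 0 T, HasDerivAt N (A₂₁ t + (A₂₂ t).comp (N t)) t) ∧
      (∀ t ∈ Icc 0 T, ‖N t‖ ≤ 2 * δ / γ) ∧ ∀ t, 0 ≤ t → t + P ≤ T → N (t + P) = N t := by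
  have h8' : 8 * δ ^ 2 ≤ (γ - 0) ^ 2 := by rw [sub_zero]; exact h8
  obtain ⟨N, hNc, hNd, hNb, hNp⟩ := riccatiGraph_periodic_on E F (fun _ => (0 : E →L[ℝ] E)) (fun _ => (0 : F →L[ℝ] E)) A₂₁ A₂₂ γ δ 0 P T
    hδ le_rfl hγ h8' hP hPT hA₂₂ (fun _ _ => by rw [norm_zero]) (fun _ _ => by rw [norm_zero]; exact hδ) h₂₁
    continuousOn_const continuousOn_const hc₂₁ hc₂₂ (fun _ _ _ => rfl) (fun _ _ _ => rfl) hp₂₁ hp₂₂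
  refine ⟨N, hNc, fun t ht => ?_, fun t ht => by simpa using hNb t ht, hNp⟩
  have h := hNd t ht
  rwa [riccati_zero_zero] at h

/-! ## §17 The Riccati graph is its linear part up to `r(s₀ + δr)/γ` (plus a transient) -/

/-- `r = 2δ/(γ−s₀) ≤ 1/√2 = 2δ′/γ` for the maximal linear coupling constant `δ′ = γ/√8` (`8δ′² = γ²`). [folklore] -/
theorem radius_le_linearRadius {γ δ s₀ : ℝ} (hδ : 0 ≤ δ) (hs₀ : 0 ≤ s₀) (hsγ : s₀ < γ) (h8 : 8 * δ ^ 2 ≤ (γ - s₀) ^ 2) :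
    2 * δ / (γ - s₀) ≤ 2 * (γ / Real.sqrt 8) / γ := by
  have hgs : 0 < γ - s₀ := by linarith
  have hγ : 0 < γ := lt_of_le_of_lt hs₀ hsγ
  have h8pos : 0 < Real.sqrt 8 := Real.sqrt_pos.mpr (by norm_num)
  have hsq : Real.sqrt 8 * Real.sqrt 8 = 8 := Real.mul_self_sqrt (by norm_num)
  rw [show 2 * (γ / Real.sqrt 8) / γ = 2 / Real.sqrt 8 by field_simp]
  rw [div_le_div_iff₀ hgs h8pos]
  -- `2δ√8 ≤ 2(γ−s₀)` ⟸ `(δ√8)² = 8δ² ≤ (γ−s₀)²`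
  have h1 : (δ * Real.sqrt 8) ^ 2 ≤ (γ - s₀) ^ 2 := by
    rw [mul_pow, Real.sq_sqrt (by norm_num)]; linarith
  have h2 : δ * Real.sqrt 8 ≤ γ - s₀ := (pow_le_pow_iff_left₀ (by positivity) hgs.le two_ne_zero).mp h1
  nlinarith

/-- **THE RICCATI GRAPH VS THE LINEAR RESPONSE.**  Under G1's hypotheses, for a Riccati graph `M` on `[0, T)` from `‖M 0‖ ≤ r = 2δ/(γ−s₀)` and any
solution `N` of the linear equation `Ṅ = A₂₁ + A₂₂N` from `‖N 0‖ ≤ 2δ/γ`: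
`‖M t − N t‖ ≤ r(s₀ + δr)/γ + (r + 2δ/γ)·e^{−(γ/2)t}` on `[0, T]` — G3 against the linear solution `L₁` from `M 0` (G0′ at `A₁₁ = A₁₂ = 0` with the
maximal coupling constant `δ′ = γ/√8`, whose ball `1/√2` contains both `M 0` and `N 0`), then G4 for `L₁ − N` at rate `γ(1 − ½)`.
[cite: KokotovicBensoussanBlankenship1987, §2 Thm 2.3 (approximation `L = D⁻¹C + O(ε)`)] -/
theorem norm_riccati_sub_linear_le (E F : Type) [NormedAddCommGroup E] [InnerProductSpace ℝ E] [FiniteDimensional ℝ E]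
    [NormedAddCommGroup F] [InnerProductSpace ℝ F] [FiniteDimensional ℝ F]
    (A₁₁ : ℝ → E →L[ℝ] E) (A₁₂ : ℝ → F →L[ℝ] E) (A₂₁ : ℝ → E →L[ℝ] F) (A₂₂ : ℝ → F →L[ℝ] F)
    (M N : ℝ → E →L[ℝ] F) (γ δ s₀ T : ℝ)
    (hδ : 0 ≤ δ) (hs₀ : 0 ≤ s₀) (hsγ : s₀ < γ) (h8 : 8 * δ ^ 2 ≤ (γ - s₀) ^ 2) (hT : 0 ≤ T)
    (hA₂₂ : ∀ t ∈ Icc 0 T, ∀ z : F, ⟪A₂₂ t z, z⟫_ℝ ≤ -γ * ‖z‖ ^ 2)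
    (h₁₁ : ∀ t ∈ Icc 0 T, ‖A₁₁ t‖ ≤ s₀) (h₁₂ : ∀ t ∈ Icc 0 T, ‖A₁₂ t‖ ≤ δ) (h₂₁ : ∀ t ∈ Icc 0 T, ‖A₂₁ t‖ ≤ δ)
    (hc₂₁ : ContinuousOn A₂₁ (Icc 0 T)) (hc₂₂ : ContinuousOn A₂₂ (Icc 0 T))
    (hMc : ContinuousOn M (Icc 0 T))
    (hMd : ∀ t ∈ Ico 0 T, HasDerivAt M (A₂₁ t + (A₂₂ t).comp (M t) - (M t).comp (A₁₁ t) - ((M t).comp (A₁₂ t)).comp (M t)) t)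
    (hM0 : ‖M 0‖ ≤ 2 * δ / (γ - s₀))
    (hNc : ContinuousOn N (Icc 0 T)) (hNd : ∀ t ∈ Ico 0 T, HasDerivAt N (A₂₁ t + (A₂₂ t).comp (N t)) t) (hN0 : ‖N 0‖ ≤ 2 * δ / γ) :
    ∀ t ∈ Icc 0 T, ‖M t - N t‖ ≤ (2 * δ / (γ - s₀)) * (s₀ + δ * (2 * δ / (γ - s₀))) / γ +
      (2 * δ / (γ - s₀) + 2 * δ / γ) * Real.exp (-(γ / 2) * t) := by
  intro t ht
  have hγ : 0 < γ := lt_of_le_of_lt hs₀ hsγ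
  have hgs : 0 < γ - s₀ := by linarith
  set r := 2 * δ / (γ - s₀) with hr
  have hr0 : 0 ≤ r := by positivity
  -- the maximal linear coupling constant `δ′ = γ/√8`
  set δ' := γ / Real.sqrt 8 with hδ'
  have h8pos : 0 < Real.sqrt 8 := Real.sqrt_pos.mpr (by norm_num)
  have hδ'0 : 0 ≤ δ' := by positivity
  have h8' : 8 * δ' ^ 2 ≤ (γ - 0) ^ 2 := by
    rw [hδ', div_pow, Real.sq_sqrt (by norm_num), sub_zero]
    exact le_of_eq (by field_simp)
  have hrad : 2 * δ' / (γ - 0) = 2 / Real.sqrt 8 := by rw [sub_zero, hδ']; field_simp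
  have hr_le : r ≤ 2 * δ' / (γ - 0) := by rw [hr]; simpa only [sub_zero] using radius_le_linearRadius hδ hs₀ hsγ h8
  have hδδ' : δ ≤ δ' := by
    -- `δ ≤ (γ − s₀)/√8 ≤ γ/√8`
    have h1 : (δ * Real.sqrt 8) ^ 2 ≤ γ ^ 2 := by
      rw [mul_pow, Real.sq_sqrt (by norm_num)]; nlinarith
    have h2 : δ * Real.sqrt 8 ≤ γ := (pow_le_pow_iff_left₀ (by positivity) hγ.le two_ne_zero).mp h1
    rw [hδ', le_div_iff₀ h8pos]; exact h2
  have hlinγ : 2 * δ / γ ≤ 2 * δ' / (γ - 0) := by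
    rw [sub_zero]; exact div_le_div_of_nonneg_right (by linarith) hγ.le
  -- hypotheses of the lever at `A₁₁ = A₁₂ = 0`, `s₀ = 0`, coupling `δ′`
  have h₁₁' : ∀ s ∈ Icc 0 T, ‖(fun _ : ℝ => (0 : E →L[ℝ] E)) s‖ ≤ 0 := fun _ _ => by rw [norm_zero]
  have h₁₂' : ∀ s ∈ Icc 0 T, ‖(fun _ : ℝ => (0 : F →L[ℝ] E)) s‖ ≤ δ' := fun _ _ => by rw [norm_zero]; exact hδ'0
  have h₂₁' : ∀ s ∈ Icc 0 T, ‖A₂₁ s‖ ≤ δ' := fun s hs => (h₂₁ s hs).trans hδδ'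
  -- the linear solution `L₁` from `M 0` (G0′ at the linear specialisation)
  obtain ⟨L₁, hL₁0, hL₁c, hL₁d', hL₁b⟩ := riccatiGraph_exists_of_norm_le E F (fun _ => (0 : E →L[ℝ] E)) (fun _ => (0 : F →L[ℝ] E)) A₂₁ A₂₂
    γ δ' 0 T hδ'0 le_rfl hγ h8' hT hA₂₂ h₁₁' h₁₂' h₂₁' continuousOn_const continuousOn_const hc₂₁ hc₂₂ (M 0) (hM0.trans hr_le)
  have hL₁d : ∀ s ∈ Ico 0 T, HasDerivAt L₁ (A₂₁ s + (A₂₂ s).comp (L₁ s)) s := fun s hs => by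
    have h := hL₁d' s hs; rwa [riccati_zero_zero] at h
  -- G3: `‖M t − L₁ t‖ ≤ r(s₀ + δr)/γ`
  have hG3 := duhamelRemainder E F A₁₁ A₁₂ A₂₁ A₂₂ M L₁ γ δ s₀ T hγ hδ hs₀ hsγ h8 hT hA₂₂ h₁₁ h₁₂ h₂₁ hMd hL₁d hMc hL₁c hL₁0 hM0 t ht
  -- G4 at the linear specialisation: `‖L₁ t − N t‖ ≤ e^{−γ(1 − (2δ′/γ)²)t} ‖M 0 − N 0‖`
  have hNd' : ∀ s ∈ Ico 0 T, HasDerivAt N (A₂₁ s + (A₂₂ s).comp (N s) - (N s).comp ((fun _ : ℝ => (0 : E →L[ℝ] E)) s) -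
      ((N s).comp ((fun _ : ℝ => (0 : F →L[ℝ] E)) s)).comp (N s)) s := fun s hs => by
    have h := hNd s hs; rwa [← riccati_zero_zero (A₂₁ s) (A₂₂ s) (N s)] at h
  have hG4 := riccati_contraction E F (fun _ => (0 : E →L[ℝ] E)) (fun _ => (0 : F →L[ℝ] E)) A₂₁ A₂₂ L₁ N γ δ' 0 T hγ hδ'0 le_rfl hγ h8' hT
    hA₂₂ h₁₁' h₁₂' h₂₁' hL₁d' hNd' hL₁c hNc (by rw [hL₁0]; exact hM0.trans hr_le) (hN0.trans hlinγ) t ht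
  have hrate : Real.exp (-((γ - 0) * (1 - (2 * δ' / (γ - 0)) ^ 2)) * t) = Real.exp (-(γ / 2) * t) := by
    rw [hrad, div_pow, Real.sq_sqrt (by norm_num), sub_zero]
    congr 1
    ring
  rw [hrate, hL₁0] at hG4
  have hMN0 : ‖M 0 - N 0‖ ≤ r + 2 * δ / γ := (norm_sub_le _ _).trans (add_le_add hM0 hN0)
  calc ‖M t - N t‖ ≤ ‖M t - L₁ t‖ + ‖L₁ t - N t‖ := by
        have e : M t - N t = (M t - L₁ t) + (L₁ t - N t) := by abel
        rw [e]; exact norm_add_le _ _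
    _ ≤ r * (s₀ + δ * r) / γ + Real.exp (-(γ / 2) * t) * ‖M 0 - N 0‖ := add_le_add hG3 hG4
    _ ≤ r * (s₀ + δ * r) / γ + Real.exp (-(γ / 2) * t) * (r + 2 * δ / γ) :=
        add_le_add le_rfl (mul_le_mul_of_nonneg_left hMN0 (Real.exp_pos _).le)
    _ = r * (s₀ + δ * r) / γ + (r + 2 * δ / γ) * Real.exp (-(γ / 2) * t) := by ring

end Linear

end SlowGraph

end Summit.AnomalousDissipation.AnomalousDissipation.Theorems.SolenoidalFractalHomogenisation.LagrangianStep

end
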